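import Summits.Ventures.AbcSig.Recipes.BS04

/-!
# Venture AbcSig — GENERATED level file, level 13: NO newforms

HONEST FRAMING. Machine-generated by the p-lean seat's `certgen.py`. The cell's level file `N13.engine1.json`
(sha256 `eefba6ccb82735458f21def34b592c6bfb28d298815254bde7b93d0016b7c604`; engine-1 (modular symbols: msym)) reports `dim S₂^new(Γ₀(13)) = 0` and an EMPTY orbit list. Second engine file `N13.msgf.json` (sha256 `f276d18db52554bd529c94bb2c6cabc92cf2f0201ff1085ea019d5904e9ee949`, p1-msgf) also reports no orbits. [BS04, Prop. 4.1] lists this level among those with no weight-2 newforms of trivial character.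
In the Lean layer this is the computed hypothesis `NewformModel.DataComplete 13 level13Orbits` with the empty list; nothing is
certified by the kernel here (an empty list needs no certificate). No claim on ABC or any summit.
-/

namespace Summit.Ventures.AbcSig

/-- The (empty) list of newform orbits of level 13. -/
def level13Orbits : List OrbitData := []

/-- Every listed entry is at an odd prime not dividing 13 (vacuous). -/
theorem level13_wellformed :
    ∀ o ∈ level13Orbits, ∀ e ∈ o.coeffs, e.ell.Prime ∧ e.ell ≠ 2 ∧ ¬ e.ell ∣ 13 := by
  intro o ho
  simp [level13Orbits] at ho

/-- **Level 13 summary**: vacuous (no orbits); same shape as the generated `levelN_sieve` theorems. -/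
theorem level13_sieve (n : ℕ) (_hn : n.Prime) (_hmin : 7 ≤ n) (X : OrbitData → Prop) :
    ∀ o ∈ level13Orbits, (∀ e ∈ o.coeffs, e.ell.Prime ∧ e.ell ≠ 2 ∧ ¬ e.ell ∣ 13) ∧ (o.Eliminated bs04Allowed n ∨ X o) := by
  intro o ho
  simp [level13Orbits] at ho

end Summit.Ventures.AbcSig
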